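import Summits.QuantumFields.GaugeBoot.FreeConfigurations
import Summits.QuantumFields.GaugeBoot.ZdLoopClasses
import HarnessLib

/-!
# Free reduction of lattice words: the holonomy FUNCTION of a word over `SU(N)`, `N ≥ 2`, is exactly its free reduction (gauge-boot, large-`N` supplement 16, part 9)

HONEST FRAMING (cell `pub-gaugeboot`, page 1 of every file): the venture produces certified bounds
on lattice expectations at stated coupling, gauge group, dimension and torus size; NOT a mass gap,
NOT a continuum limit, NOT a string tension; NOT large `N` unless marked CONDITIONAL; NOT
Yang–Mills-summit-bearing (barriers `FixedCouplingUltralocality`, `PerturbativeInvisibility`).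
Lattice combinatorics; this file certifies no number.

## Content

Parts 2–7 are stated for REDUCED words.  This part removes the restriction with the lane's free reduction
`Word.freeReduce` (`LoopClasses.lean`, the stack algorithm; `wordHolonomyZd_freeReduce` of `ZdLoopClasses.lean`:
same holonomy on every configuration, any group):

* `Word.isChain_freeReduce` — the free reduction IS reduced (no letter followed by its inverse);
  `Word.freeReduce_eq_self_of_isChain` (a reduced word is its own reduction), `Word.freeReduce_freeReduce`,
  `endpointZd_freeReduce`;
* for every gauge group with a free pair (`SU(N)`, `U(N)`, `N ≥ 2`; `SO(N)`, `N ≥ 3`):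
  ★★★ `forall_wordHolonomyZd_eq_iff_freeReduce_eq_of_freePair` — **two lattice words have the same holonomy
  on EVERY configuration iff they have the same free reduction**; ★★ `forall_wordHolonomyZd_eq_one_iff_freeReduce_eq_nil_of_freePair`
  — **a word has holonomy identically `1` iff it freely reduces to the empty word** (null-homotopic in the
  edge graph; for abelian groups null-homologous suffices and part 8's commutator shows the difference);
  ★★★ `exists_isNonBacktrackingLoop_realising_iff_freeReduce_of_freePair` — THE EXACT DOMAIN FOR EVERY WORD:
  `w` is realised by a non-backtracking closed walk iff its free reduction is closed and cyclically reduced;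
  `SU(N)` spellings `…_suN`; example `freeReduce_plaqWord_self` (`plaqWord a a ε` reduces to nothing).

[folklore] (the lattice bookkeeping is ours).
-/

noncomputable section

open SimpleGraph
open Literature.Probability.LatticeModels (Site zdGraph)
open Literature.MathematicalPhysics.QuantumLattice
open Literature.MathematicalPhysics.QuantumFieldTheory (IsNonBacktrackingLoop)

namespace Summit.QuantumFields.GaugeBoot

variable {d : ℕ}

/-! ## The free reduction is reduced -/

/-- Unfolding `freeReduce` on a `cons`. [folklore] -/
theorem Word.freeReduce_cons (s : Step d) (w : Word d) :
    Word.freeReduce (s :: w) = (match Word.freeReduce w with | [] => [s] | t :: v => if t = s.inv then v else s :: t :: v) := rfl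

/-- **The free reduction of a word is reduced**: no letter is followed by its inverse. [folklore] -/
theorem Word.isChain_freeReduce : ∀ w : Word d, (Word.freeReduce w).IsChain (fun s t => t ≠ s.inv)
  | [] => List.IsChain.nil
  | s :: w => by
    have ih := Word.isChain_freeReduce w
    rw [Word.freeReduce_cons]
    cases hfw : Word.freeReduce w with
    | nil => exact List.isChain_singleton _
    | cons t v =>
      rw [hfw] at ih
      by_cases ht : t = s.inv
      · simp only [ht, ↓reduceIte]
        rw [ht] at ih
        exact ih.tail
      · simp only [ht, ↓reduceIte]
        exact List.IsChain.cons_cons ht ih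

/-- **A reduced word is its own free reduction.** [folklore] -/
theorem Word.freeReduce_eq_self_of_isChain : ∀ {w : Word d}, w.IsChain (fun s t => t ≠ s.inv) → Word.freeReduce w = w
  | [], _ => rfl
  | [s], _ => rfl
  | s :: t :: v, h => by
    obtain ⟨hst, h'⟩ := List.isChain_cons_cons.1 h
    rw [Word.freeReduce_cons, Word.freeReduce_eq_self_of_isChain h']
    simp [hst]

/-- Free reduction is idempotent. [folklore] -/
theorem Word.freeReduce_freeReduce (w : Word d) : Word.freeReduce (Word.freeReduce w) = Word.freeReduce w :=
  Word.freeReduce_eq_self_of_isChain (Word.isChain_freeReduce w)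

/-- Free reduction does not change the endpoint. [folklore] -/
theorem endpointZd_freeReduce (x : Site d) (w : Word d) : Word.endpointZd x (Word.freeReduce w) = Word.endpointZd x w := by
  rw [endpointZd_eq_add_disp, endpointZd_eq_add_disp, Word.disp_freeReduce]

/-- A cyclically reduced word is its own free reduction. [folklore] -/
theorem Word.freeReduce_eq_self_of_cyclicallyReduced {w : Word d} (hw : w.CyclicallyReduced) : Word.freeReduce w = w :=
  Word.freeReduce_eq_self_of_isChain hw.2.left_of_append

/-! ## Gauge groups with a free pair: the holonomy function IS the free reduction -/

section FreePair

variable {G : Type*} [Group G]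

/-- ★★★ **Two lattice words have the same holonomy on every configuration iff they have the same free reduction**
(gauge group with a free pair). [folklore] -/
theorem forall_wordHolonomyZd_eq_iff_freeReduce_eq_of_freePair (ψ : FreeGroup (Fin 2) →* G) (hψ : Function.Injective ψ)
    (x : Site d) (w w' : Word d) :
    (∀ U : LGConfig d G, wordHolonomyZd U x w = wordHolonomyZd U x w') ↔ Word.freeReduce w = Word.freeReduce w' := by
  constructor
  · intro h
    exact eq_of_forall_wordHolonomyZd_eq_of_freePair ψ hψ x (Word.isChain_freeReduce w) (Word.isChain_freeReduce w') fun U => by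
      rw [wordHolonomyZd_freeReduce, wordHolonomyZd_freeReduce, h U]
  · intro h U
    rw [← wordHolonomyZd_freeReduce U w x, h, wordHolonomyZd_freeReduce]

/-- ★★ **A lattice word has holonomy identically `1` iff it freely reduces to the empty word** (gauge group with a
free pair; "null-homotopic in the edge graph"). [folklore] -/
theorem forall_wordHolonomyZd_eq_one_iff_freeReduce_eq_nil_of_freePair (ψ : FreeGroup (Fin 2) →* G) (hψ : Function.Injective ψ)
    (x : Site d) (w : Word d) : (∀ U : LGConfig d G, wordHolonomyZd U x w = 1) ↔ Word.freeReduce w = [] := by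
  have h := forall_wordHolonomyZd_eq_iff_freeReduce_eq_of_freePair ψ hψ x w []
  simp only [wordHolonomyZd_nil] at h
  rw [h]
  rfl

/-- ★★★ **THE EXACT DOMAIN OF THE WALK HYPOTHESES FOR EVERY WORD** (gauge group with a free pair): `w` is realised by
a non-backtracking closed walk — same holonomy on every configuration — iff its FREE REDUCTION is closed and
cyclically reduced. [folklore] -/
theorem exists_isNonBacktrackingLoop_realising_iff_freeReduce_of_freePair (ψ : FreeGroup (Fin 2) →* G)
    (hψ : Function.Injective ψ) (x : Site d) (w : Word d) :
    (∃ γ : (zdGraph d).Walk x x, IsNonBacktrackingLoop γ ∧ ∀ U : LGConfig d G, walkHolonomy U γ = wordHolonomyZd U x w) ↔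
      Word.endpointZd x (Word.freeReduce w) = x ∧ (Word.freeReduce w).CyclicallyReduced := by
  rw [← exists_isNonBacktrackingLoop_realising_iff_of_freePair ψ hψ x (Word.isChain_freeReduce w)]
  simp only [wordHolonomyZd_freeReduce]

/-- Loops of equal words are equal (transport of the closing proof). [folklore] -/
theorem Word.toLoopZd_congr {x : Site d} {w₁ w₂ : Word d} (e : w₁ = w₂) (h₁ : Word.endpointZd x w₁ = x) (h₂ : Word.endpointZd x w₂ = x) :
    Word.toLoopZd x w₁ h₁ = Word.toLoopZd x w₂ h₂ := by
  subst e; rfl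

/-- **… and then the realising walk is the loop of the free reduction.** [folklore] -/
theorem eq_toLoopZd_freeReduce_of_realising_of_freePair (ψ : FreeGroup (Fin 2) →* G) (hψ : Function.Injective ψ) (x : Site d)
    (w : Word d) (γ : (zdGraph d).Walk x x) (hγ : IsNonBacktrackingLoop γ)
    (hhol : ∀ U : LGConfig d G, walkHolonomy U γ = wordHolonomyZd U x w) :
    ∃ hx : Word.endpointZd x (Word.freeReduce w) = x, γ = Word.toLoopZd x (Word.freeReduce w) hx := by
  have hcr : (walkWordZd γ).CyclicallyReduced := (cyclicallyReduced_walkWordZd_iff γ).2 hγ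
  have heq : walkWordZd γ = Word.freeReduce w :=
    eq_of_forall_wordHolonomyZd_eq_of_freePair ψ hψ x hcr.2.left_of_append (Word.isChain_freeReduce w) fun U => by
      rw [wordHolonomyZd_walkWordZd, hhol U, wordHolonomyZd_freeReduce]
  have hxr : Word.endpointZd x (Word.freeReduce w) = x := by rw [← heq]; exact endpointZd_walkWordZd γ
  exact ⟨hxr, (toLoopZd_walkWordZd γ).symm.trans (Word.toLoopZd_congr heq _ hxr)⟩

end FreePair

/-! ## `SU(N)`, `N ≥ 2` -/

/-- ★★★ **`SU(N)`, `N ≥ 2`: two words have the same holonomy function iff they have the same free reduction.** [folklore] -/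
theorem forall_wordHolonomyZd_eq_iff_freeReduce_eq_suN {N : ℕ} (hN : 2 ≤ N) (x : Site d) (w w' : Word d) :
    (∀ U : LGConfig d (SU N), wordHolonomyZd U x w = wordHolonomyZd U x w') ↔ Word.freeReduce w = Word.freeReduce w' := by
  obtain ⟨ψ, hψ⟩ := freePairSU hN
  exact forall_wordHolonomyZd_eq_iff_freeReduce_eq_of_freePair ψ hψ x w w'

/-- ★★ **`SU(N)`, `N ≥ 2`: a word has holonomy identically `1` iff it freely reduces to nothing.** [folklore] -/
theorem forall_wordHolonomyZd_eq_one_iff_freeReduce_eq_nil_suN {N : ℕ} (hN : 2 ≤ N) (x : Site d) (w : Word d) :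
    (∀ U : LGConfig d (SU N), wordHolonomyZd U x w = 1) ↔ Word.freeReduce w = [] := by
  obtain ⟨ψ, hψ⟩ := freePairSU hN
  exact forall_wordHolonomyZd_eq_one_iff_freeReduce_eq_nil_of_freePair ψ hψ x w

/-- ★★★ **`SU(N)`, `N ≥ 2`: the exact domain of the walk hypotheses for every word.** [folklore] -/
theorem exists_isNonBacktrackingLoop_realising_iff_freeReduce_suN {N : ℕ} (hN : 2 ≤ N) (x : Site d) (w : Word d) :
    (∃ γ : (zdGraph d).Walk x x, IsNonBacktrackingLoop γ ∧ ∀ U : LGConfig d (SU N), walkHolonomy U γ = wordHolonomyZd U x w) ↔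
      Word.endpointZd x (Word.freeReduce w) = x ∧ (Word.freeReduce w).CyclicallyReduced := by
  obtain ⟨ψ, hψ⟩ := freePairSU hN
  exact exists_isNonBacktrackingLoop_realising_iff_freeReduce_of_freePair ψ hψ x w

/-- `SO(N)`, `N ≥ 3`: the exact domain of the walk hypotheses for every word. [folklore] -/
theorem exists_isNonBacktrackingLoop_realising_iff_freeReduce_SO {N : ℕ} (hN : 3 ≤ N) (x : Site d) (w : Word d) :
    (∃ γ : (zdGraph d).Walk x x, IsNonBacktrackingLoop γ ∧ ∀ U : LGConfig d (SO N), walkHolonomy U γ = wordHolonomyZd U x w) ↔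
      Word.endpointZd x (Word.freeReduce w) = x ∧ (Word.freeReduce w).CyclicallyReduced := by
  obtain ⟨ψ, hψ⟩ := freePairSO hN
  exact exists_isNonBacktrackingLoop_realising_iff_freeReduce_of_freePair ψ hψ x w

/-- Example: the degenerate plaquette word `plaqWord a a ε` freely reduces to nothing (its holonomy is `≡ 1`);
by `decide`-free reasoning through `SU(2)`. [folklore] -/
theorem freeReduce_plaqWord_self (a : Fin d) (ε : Bool) : Word.freeReduce (plaqWord a a ε) = [] :=
  (forall_wordHolonomyZd_eq_one_iff_freeReduce_eq_nil_suN (N := 2) le_rfl (0 : Site d) _).1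
    fun U => wordHolonomyZd_plaqWord_self U 0 a ε

end Summit.QuantumFields.GaugeBoot

end
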